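import Literature.AlgebraicGeometry.HodgeTheory.ComplexOrientationDegreeEtaleLocus
import Literature.AlgebraicGeometry.HodgeTheory.ComplexOrientationCycleClassFacts
import Literature.AlgebraicGeometry.Motives.SteinFactorizationCurve
import HarnessLib

/-!
# Fulton's degree formula for the complex orientations, reduced to two statements of algebraic
# geometry (general fibres of a generically finite morphism; resolving a rational map)

Family `hodge`, layer `Literature/AlgebraicGeometry/HodgeTheory`. The named fact
`Fulton1998_degreeFormula_complexOrientation` (`HodgeTheory/ComplexOrientationCycleClassFacts`:
`g_* 1_V = k • τ_* 1_W` in `H^{2e}(X(ℂ); ℂ)` for `g : V ⟶ X` of degree `k` and `τ : W ⟶ X` of degree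
`1` onto the same subvariety, Fulton Lemma 19.1.2 for the COMPLEX orientations) has a topological
half — holomorphic maps have local degree `+1` — and an algebro-geometric half. The topological half
is proved in the tree (`complexGysin_complexOrientationFamily_one_of_isBirational`: `p_* 1 = 1` for
`p` birational; `complexGysin_complexOrientationFamily_one_of_fibre_subset_smoothLocus`: `q_* 1 = k • 1`
over a fibre of `k` complex points in the smooth locus; generic smoothness
`Motives.exists_smooth_morphismRestrict_of_charZero`, Hartshorne III Cor. 10.7). This file proves the
ASSEMBLY, leaving exactly two statements of algebraic geometry as hypotheses:

* `(h4)` **general fibres of a generically finite morphism** (Harris, *Algebraic Geometry*,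
  Prop. 7.16; Shafarevich, *Basic Algebraic Geometry 1*, II.6.3 Thm. 2.28, characteristic `0`): for
  `q : T ⟶ W` between smooth projective `d`-folds with `q_*[T] = k • [W]` as cycles (`k ≥ 1`, i.e.
  `q` dominant of degree `k = [K(T) : K(W)]`), every non-empty open `V ⊆ W` contains a complex point
  `b` whose fibre `q(ℂ)⁻¹(b)` consists of exactly `k` complex points;
* `(h5)` **resolving the rational map `τ⁻¹ ∘ g : V ⇢ W`** (elimination of indeterminacy,
  Hartshorne II Example 7.17.3, followed by Hironaka's resolution): in the situation of the degree
  formula there are a smooth projective `d`-fold `T` and morphisms `p : T ⟶ V` birational,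
  `q : T ⟶ W` with `p ≫ g = q ≫ τ` and `q_*[T] = k • [W]`;

and concludes `Fulton1998_degreeFormula_complexOrientation`:
`g_* 1_V = g_* p_* 1_T = (p ≫ g)_* 1_T = (q ≫ τ)_* 1_T = τ_* q_* 1_T = τ_* (k • 1_W) = k • τ_* 1_W`
(functoriality `complexGysin_comp`).

* `Fulton1998_degreeFormula_complexOrientation_of` — the assembly (everything proved; `h4`, `h5`
  are hypotheses of the theorem, not named facts).

## References

* [Fulton1998] W. Fulton, Intersection Theory, 2nd ed., Springer 1998, §1.4, Lemma 19.1.2.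
* [Harris1992] J. Harris, Algebraic Geometry: A First Course, GTM 133, Springer 1992, Prop. 7.16.
* [Hartshorne1977] R. Hartshorne, Algebraic Geometry, GTM 52, Springer 1977, II Ex. 7.17.3, III Cor. 10.7.
* [Hironaka1964] H. Hironaka, Resolution of singularities …, Ann. of Math. 79 (1964), Main Theorem I.
-/

noncomputable section

open CategoryTheory AlgebraicGeometry Order Set
open Literature.AlgebraicTopology.SingularHomology

namespace Literature.AlgebraicGeometry.HodgeTheory

section HodgeTheory

open Literature.AlgebraicGeometry.Motives

universe u

/-- Over a locally Noetherian base, locally of finite type implies locally of finite presentation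
(the argument of `AlgebraicityLocusCurves.locallyOfFinitePresentation_of_isLocallyNoetherian`,
repeated to keep the imports light). [folklore] -/
private theorem locallyOfFinitePresentation_of_isLocallyNoetherian_aux {X Y : Scheme.{u}} (g : X ⟶ Y)
    [IsLocallyNoetherian Y] [LocallyOfFiniteType g] : LocallyOfFinitePresentation g := by
  rw [HasRingHomProperty.iff_appLE (P := @LocallyOfFinitePresentation)]
  intro U V e
  haveI := IsLocallyNoetherian.component_noetherian (X := Y) U
  exact RingHom.FinitePresentation.of_finiteType.mp
    (HasRingHomProperty.appLE @LocallyOfFiniteType g inferInstance U V e)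

/-- **Fulton's degree formula for the complex orientations from two statements of algebraic
geometry.** Hypotheses: `h4` — a general complex point of the target of a dominant morphism
`q : T ⟶ W` of degree `k` between smooth projective `d`-folds (`q_*[T] = k • [W]` as cycles) has
exactly `k` complex points in its fibre, generality being with respect to any given non-empty
Zariski-open `V ⊆ W` [cite: Harris1992, Prop. 7.16]; `h5` — the rational map `τ⁻¹ ∘ g` from `V` to
the birational model `W` of `g(V)` is resolved by a smooth projective `T`: `p : T ⟶ V` birational and
`q : T ⟶ W` of degree `k` with `p ≫ g = q ≫ τ` [cite: Hartshorne1977, II Example 7.17.3]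
[cite: Hironaka1964, Main Theorem I]. Conclusion: `Fulton1998_degreeFormula_complexOrientation`,
i.e. `g_* 1_V = k • τ_* 1_W` for the Gysin morphisms of the complex orientation family — by generic
smoothness of `q` (Hartshorne III Cor. 10.7, PROVED in the tree), `q_* 1 = k • 1` over a general fibre
in the smooth locus and `p_* 1 = 1` (holomorphic maps have local degree `+1`), and functoriality.
[cite: Fulton1998, Lemma 19.1.2] -/
theorem Fulton1998_degreeFormula_complexOrientation_of
    (h4 : ∀ ⦃d : ℕ⦄ ⦃T W : Motives.SchemeOver ℂ⦄ (hT : IsSmoothProjective d T)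
      (hW : IsSmoothProjective d W) (q : T ⟶ W) [QuasiCompact q.left] ⦃θ : T.left⦄ ⦃ω : W.left⦄,
      IsGenericPoint θ Set.univ → IsGenericPoint ω Set.univ → ∀ ⦃k : ℕ⦄, 0 < k →
      AlgebraicCycle.map q.left height height (Motives.primeCycle θ) = k • Motives.primeCycle ω →
      ∀ V : W.left.Opens, (V : Set W.left).Nonempty →
        ∃ b : ComplexPoints W, b.pt ∈ V ∧ ∃ v : Fin k → ComplexPoints T,
          Function.Injective v ∧ (AlgPoints.map q) ⁻¹' {b} = Set.range v)
    (h5 : ∀ ⦃n d e : ℕ⦄ ⦃X V W : Motives.SchemeOver ℂ⦄ (hX : IsSmoothProjective n X)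
      (hV : IsSmoothProjective d V) (hW : IsSmoothProjective d W) (_hde : d + e = n)
      (g : V ⟶ X) (τ : W ⟶ X) [QuasiCompact g.left] [QuasiCompact τ.left] ⦃η : V.left⦄ ⦃ω : W.left⦄,
      IsGenericPoint η Set.univ → IsGenericPoint ω Set.univ → ∀ ⦃z : X.left⦄ ⦃k : ℕ⦄, 0 < k →
      AlgebraicCycle.map g.left height height (Motives.primeCycle η) = k • Motives.primeCycle z →
      AlgebraicCycle.map τ.left height height (Motives.primeCycle ω) = Motives.primeCycle z →
      ∃ (T : Motives.SchemeOver ℂ) (_ : IsSmoothProjective d T) (p : T ⟶ V) (q : T ⟶ W)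
        (_ : QuasiCompact q.left) (θ : T.left), IsGenericPoint θ Set.univ ∧ p ≫ g = q ≫ τ ∧
        Resolution.IsBirational p.left ∧
        AlgebraicCycle.map q.left height height (Motives.primeCycle θ) = k • Motives.primeCycle ω) :
    Fulton1998_degreeFormula_complexOrientation := by
  intro n d e X V W hX hV hW hde g τ _ _ η ω hη hω z k hk hg hτ
  obtain ⟨T, hT, p, q, hqc, θ, hθ, hsq, hp, hq⟩ := h5 hX hV hW hde g τ hη hω hk hg hτ
  -- generic smoothness for `q`
  haveI : IsProper T.hom := IsSmoothProjective.isProper_holds hT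
  haveI : IsProper W.hom := IsSmoothProjective.isProper_holds hW
  haveI := hT.smoothOfRelativeDimension
  haveI := hW.smoothOfRelativeDimension
  haveI : IsIntegral W.left := IsSmoothProjective.isIntegral_holds hW
  haveI := IsSmoothProjective.isLocallyNoetherian_holds hW
  haveI : IsProper (q.left ≫ W.hom) := by
    rw [Over.w q]
    infer_instance
  haveI : IsProper q.left := IsProper.of_comp q.left W.hom
  haveI : LocallyOfFinitePresentation q.left :=
    locallyOfFinitePresentation_of_isLocallyNoetherian_aux q.left
  obtain ⟨U, hUgen, -, hUsm⟩ := Motives.exists_smooth_morphismRestrict_of_charZero (n := d) q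
  haveI := hUsm
  haveI : Smooth ((q.left ⁻¹ᵁ U).ι ≫ q.left) := by
    rw [← morphismRestrict_ι]
    infer_instance
  -- a general fibre in the smooth locus
  obtain ⟨b, hbU, v, hv, hfib⟩ := h4 hT hW q hθ hω hk hq U ⟨_, hUgen⟩
  have hvU : ∀ i, (v i).pt ∈ q.left ⁻¹ᵁ U := fun i ↦ by
    have h1 : AlgPoints.map q (v i) = b := by
      have h2 : v i ∈ AlgPoints.map q ⁻¹' {b} := by
        rw [hfib]
        exact ⟨i, rfl⟩
      exact h2
    change q.left.base (v i).pt ∈ U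
    rw [← AlgPoints.pt_map, h1]
    exact hbU
  have hqk : complexGysin complexOrientationFamily hT hW q (rfl : 0 + 2 * d = 0 + 2 * d)
      (singularCohomology.one ℂ (ComplexPoints T)) =
      (k : ℂ) • singularCohomology.one ℂ (ComplexPoints W) := by
    have h1 := complexGysin_complexOrientationFamily_one_of_fibre_subset_smoothLocus hT hW q
      (q.left ⁻¹ᵁ U) hv hfib hvU
    rwa [Fintype.card_fin] at h1
  have hp1 := complexGysin_complexOrientationFamily_one_of_isBirational hT hV p hp
  -- functoriality
  have hμ : complexOrientationFamily.HasPoincareDuality := hasPoincareDuality_complexOrientationFamily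
  have e1 := complexGysin_comp hμ hT hV hX p g (rfl : 0 + 2 * d = 0 + 2 * d)
    (show 0 + 2 * n = 2 * e + 2 * d by omega)
  have e2 := complexGysin_comp hμ hT hW hX q τ (rfl : 0 + 2 * d = 0 + 2 * d)
    (show 0 + 2 * n = 2 * e + 2 * d by omega)
  have e3 := congrArg (fun φ : T ⟶ X ↦ complexGysin complexOrientationFamily hT hX φ
    (show 0 + 2 * n = 2 * e + 2 * d by omega) (singularCohomology.one ℂ (ComplexPoints T))) hsq
  rw [e1, e2, LinearMap.comp_apply, LinearMap.comp_apply, hp1, hqk, map_smul] at e3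
  exact e3

end HodgeTheory

end Literature.AlgebraicGeometry.HodgeTheory

end
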